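import Summits.HubbardSuperconductivity.HubbardSuperconductivity.Theorems.AnisotropyChordTransferFibre3FinX3Eval

/-!
# Route `AnisotropyChord` / H0 rotor rung: FIN per-`L` GM₃ (X3, `L ≥ 25`) — the side-condition cell with `nt` given is sound

Soundness of `…FinX3Eval.sdOKzN` / `sdCellAnyZN` (g7's `sdz_cell_sound` with `T⁺ = 3λ₂ + (T⁺ − 3λ₂)` read from the INPUT bracket
`nt` instead of g5's objects): given `T⁺ − 3λ₂ ∈ nt` (exported by the combined X3 cell of the same λ-cell, `…FinX3SoundC`), a passing
check gives, for every ground two-magnon profile of the cell (`5 ≤ L`, `0 ≤ Δ < 1`), the regime `0 ≤ mHole` and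
`facMI·η_eff·(aD + (bn/bd)/(2 + cos θ)) < c`: ★ `sdzN_cell_sound`, cover form ★ `sdzN_cellAny_sound`.
Prover seat `hubbard-h0-rotor-p3` g8; helper for piece A = stmt-HubbardSuperconductivity-23918 of rung 19089 (`--supports`, helper
class).  WHAT THIS IS NOT: nothing here proves superconductivity in the Hubbard model (rotor TARGET as worded stays FALSE, g15 verdict);
the regime clause / side condition (per `L`, per cell) of ONE conditional reduction.  Tree imports only; no sorry, no new axioms.
-/

set_option linter.dupNamespace false
set_option autoImplicit false

namespace Summit.HubbardSuperconductivity.HubbardSuperconductivity.Theorems.AnisotropyChord.Transfer.Fibre3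

namespace FinXD

open scoped BigOperators
open Finset Hole2 FinCell FinXB

section sound

variable {L : ℕ} [NeZero L]

/-- ★ THE X3 SIDE-CONDITION CHECK IS SOUND: for every ground profile of the cell with `T⁺ − 3λ₂ ∈ nt`, `0 ≤ mHole` and
`facMI·η_eff·(aD + (bn/bd)/(2 + cos(2π/L))) < c`. [folklore] -/
theorem sdzN_cell_sound (hL : 5 ≤ L) {Δ lam2 : ℝ} (hΔ0 : 0 ≤ Δ) (hΔ1 : Δ < 1) {f : Tor L → ℝ}
    (hf : IsGroundTwoMagnon L Δ lam2 f) {la lb : ℤ}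
    (hla : (la : ℝ) ≤ lam2 * ((D : ℤ) : ℝ)) (hlb : lam2 * ((D : ℤ) : ℝ) ≤ (lb : ℝ))
    {nt : Iv} (hnt : mem (Tplus L Δ f - 3 * lam2) nt)
    {c : ℚ} {bn bd : ℕ} {aD : ℚ} (hcert : sdOKzN L la lb c bn bd aD nt = true) :
    0 ≤ mHole L Δ f ∧
      facMI L Δ f * etaEff L lam2 * ((aD : ℝ) + ((bn : ℝ) / bd) / (2 + Real.cos (2 * Real.pi / L))) < (c : ℝ) := by
  have hL3 : 3 ≤ L := by omega
  have hD := D_pos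
  unfold sdOKzN at hcert
  simp only [Bool.and_eq_true, decide_eq_true_eq] at hcert
  obtain ⟨⟨⟨⟨⟨⟨⟨⟨⟨hchk, hsc⟩, hbd⟩, hm0⟩, hgap⟩, hg0n⟩, hg0d⟩, hg0⟩, hrho⟩, hlhs⟩ := hcert
  have H : CellHyp (L := L) Δ lam2 f la lb := ⟨hL, hΔ0, hΔ1, hf, hla, hlb, hchk, hsc⟩
  obtain ⟨mlam, -, -, mdelta, -, -, -, -, -, -, meps⟩ := H.hS
  -- `T⁺ = 3λ₂ + (T⁺ − 3λ₂)`
  have mT : mem (Tplus L Δ f) (sdDataN L la lb bn bd aD nt).tplus := by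
    unfold sdDataN; simp only
    have e : Tplus L Δ f = 3 * lam2 + (Tplus L Δ f - 3 * lam2) := by ring
    rw [e]
    have h3 := mem_iscale 3 mlam
    push_cast at h3
    exact mem_iadd h3 hnt
  -- `m`
  have hV : ((L * L : ℕ) : ℝ) = (L : ℝ) ^ 2 := by push_cast; ring
  have hLpos : (0 : ℝ) < L := by exact_mod_cast (show 0 < L by omega)
  have hVV : (0 : ℤ) < (((L * L) * (L * L) : ℕ) : ℤ) := by positivity
  have mc2 : mem (1 - 5 / (L : ℝ) ^ 2 + 6 / ((L : ℝ) ^ 2) ^ 2)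
      (idivn (iconst ((((L * L) * (L * L) : ℕ) : ℤ) - 5 * ((L * L : ℕ) : ℤ) + 6)) ((((L * L) * (L * L) : ℕ) : ℤ))) := by
    have h := mem_idivn (mem_iconst ((((L * L) * (L * L) : ℕ) : ℤ) - 5 * ((L * L : ℕ) : ℤ) + 6)) hVV
    have hL0 : (L : ℝ) ≠ 0 := ne_of_gt hLpos
    have e : (((((L * L) * (L * L) : ℕ) : ℤ) - 5 * ((L * L : ℕ) : ℤ) + 6 : ℤ) : ℝ) / ((((L * L) * (L * L) : ℕ) : ℤ) : ℝ)
        = 1 - 5 / (L : ℝ) ^ 2 + 6 / ((L : ℝ) ^ 2) ^ 2 := by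
      push_cast
      field_simp
    rw [← e]; exact_mod_cast h
  have mm : mem (mHole L Δ f) (sdDataN L la lb bn bd aD nt).m := by
    have h := mem_isub (mem_idivn (mem_imul meps mc2) (by norm_num : (0 : ℤ) < 2)) mT
    unfold mHole
    have e : eps1 L * (1 - 5 / (L : ℝ) ^ 2 + 6 / ((L : ℝ) ^ 2) ^ 2) / 2
        = eps1 L * (1 - 5 / (L : ℝ) ^ 2 + 6 / ((L : ℝ) ^ 2) ^ 2) / ((2 : ℤ) : ℝ) := by norm_num
    rw [e]
    unfold sdDataN at h ⊢; simp only at h ⊢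
    exact h
  have hmnn : 0 ≤ mHole L Δ f := by
    have h1 : (0 : ℝ) ≤ (((sdDataN L la lb bn bd aD nt).m.1 : ℤ) : ℝ) := by exact_mod_cast hm0
    nlinarith [mm.1]
  refine ⟨hmnn, ?_⟩
  -- `κ_E`, `ĝ₀`, `fac`
  have mgap : mem (2 * eps1 L - Tplus L Δ f) (sdDataN L la lb bn bd aD nt).gap := by
    have h := mem_isub (mem_iscale 2 meps) mT
    push_cast at h
    unfold sdDataN at h ⊢; simp only at h ⊢; exact h
  have mkap : mem (kappaE L Δ f)
      (imul (iscale 3 (xbScal L la lb (gresCellTab L (cosTab L) la lb)).eps1) (iinv (sdDataN L la lb bn bd aD nt).gap)) := by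
    unfold kappaE
    rw [div_eq_mul_one_div]
    have h3 := mem_iscale 3 meps
    push_cast at h3
    exact mem_imul h3 (mem_iinv mgap hgap)
  have mg0n : mem (3 * (1 - Δ) + mHole L Δ f) (sdDataN L la lb bn bd aD nt).g0n := by
    have h := mem_iadd (mem_iscale 3 (mem_isub mem_one mdelta)) mm
    push_cast at h
    unfold sdDataN at h ⊢; simp only at h ⊢; exact h
  have mg0d : mem (3 + mHole L Δ f) (sdDataN L la lb bn bd aD nt).g0d := by
    have h := mem_iadd (mem_iconst 3) mm
    push_cast at h
    unfold sdDataN at h ⊢; simp only at h ⊢; exact h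
  have mg0 : mem (g0hat L Δ f) (sdDataN L la lb bn bd aD nt).g0 := by
    unfold g0hat
    rw [div_eq_mul_one_div]
    have h := mem_imul mg0n (mem_iinv mg0d hg0d)
    unfold sdDataN at h ⊢; simp only at h ⊢; exact h
  have mfac : mem (facMI L Δ f) (sdDataN L la lb bn bd aD nt).fac := by
    unfold facMI
    rw [div_eq_mul_one_div]
    have h := mem_iadd mem_one (mem_imul (mem_imul mkap mdelta) (mem_iinv mg0 hg0))
    unfold sdDataN at h ⊢; simp only at h ⊢; exact h
  -- `η`, `ρ`, the sum
  have mEta : mem (etaEff L lam2) (sdDataN L la lb bn bd aD nt).eta := by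
    unfold etaEff
    have h := mem_idivn (mem_iscale (L * L) mlam) (by norm_num : (0 : ℤ) < 4)
    rw [hV] at h
    push_cast at h
    unfold sdDataN; simp only; exact h
  have mrho : mem (2 + Real.cos (2 * Real.pi / L)) (sdDataN L la lb bn bd aD nt).rho := by
    have hc := mem_cosIv hL3 (show 1 < L by omega)
    have e : Real.cos (2 * Real.pi * (1 : ℕ) / L) = Real.cos (2 * Real.pi / L) := by push_cast; rw [mul_one]
    rw [e] at hc
    have h := mem_iadd (mem_iconst 2) hc
    push_cast at h
    unfold sdDataN; simp only
    rw [getIv_cosTab (show 1 < L by omega)]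
    exact h
  have msum : mem ((aD : ℝ) + ((bn : ℝ) / bd) / (2 + Real.cos (2 * Real.pi / L)))
      (iadd (qIv aD) (imul (qIv ((bn : ℚ) / bd)) (iinv (sdDataN L la lb bn bd aD nt).rho))) := by
    rw [div_eq_mul_one_div ((bn : ℝ) / bd)]
    have hb : mem ((bn : ℝ) / bd) (qIv ((bn : ℚ) / bd)) := by
      have := mem_qIv ((bn : ℚ) / bd); push_cast at this; exact this
    exact mem_iadd (mem_qIv aD) (mem_imul hb (mem_iinv mrho hrho))
  have mlhs : mem (facMI L Δ f * etaEff L lam2 * ((aD : ℝ) + ((bn : ℝ) / bd) / (2 + Real.cos (2 * Real.pi / L))))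
      (sdDataN L la lb bn bd aD nt).lhs := by
    have h := mem_imul (mem_imul mfac mEta) msum
    unfold sdDataN at h ⊢; simp only at h ⊢; exact h
  have hup := mlhs.2
  have hc : ((((sdDataN L la lb bn bd aD nt).lhs.2 : ℤ) : ℚ) : ℝ) < ((c * (D : ℚ) : ℚ) : ℝ) := by exact_mod_cast hlhs
  push_cast at hc
  nlinarith [hup, hc, hD]

end sound

/-- ★ one X3 side-condition cell: for a ground profile at `0 < Δ ≤ Δ₁ < 1` with `λ₂·D` in a cell passing `sdCellAnyZN` and
`T⁺ − 3λ₂ ∈ nt`, `0 ≤ mHole` and `facMI·η_eff·(aD + (bn/bd)/(2 + cos θ)) < c`. [folklore] -/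
theorem sdzN_cellAny_sound (L : ℕ) [NeZero L] (hL : 5 ≤ L) {d1 : ℚ} {bd : ℕ} {Δ lam2 : ℝ} (hΔ0 : 0 < Δ)
    (hΔd : Δ ≤ (d1 : ℝ)) (hΔ1 : Δ < 1) {f : Tor L → ℝ} (hf : IsGroundTwoMagnon L Δ lam2 f) {la lb : ℤ}
    (hla : (la : ℝ) ≤ lam2 * ((D : ℤ) : ℝ)) (hlb : lam2 * ((D : ℤ) : ℝ) ≤ (lb : ℝ)) {t : ℚ × ℕ × ℚ} {nt : Iv}
    (hnt : mem (Tplus L Δ f - 3 * lam2) nt)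
    (hok : sdCellAnyZN L d1 bd la lb t nt = true) :
    0 ≤ mHole L Δ f ∧
      facMI L Δ f * etaEff L lam2 * ((t.2.2 : ℝ) + ((t.2.1 : ℝ) / bd) / (2 + Real.cos (2 * Real.pi / L))) < (t.1 : ℝ) := by
  have hL3 : 3 ≤ L := by omega
  have hD := D_pos
  have hlam : 0 < lam2 := lam2_pos L hL3 hΔ1 hf.1
  have hΔe : Δ = deltaOfLam L lam2 := ground_delta_eq L hL hΔ0.le hΔ1 hf
  unfold sdCellAnyZN at hok
  simp only [Bool.or_eq_true, Bool.and_eq_true, decide_eq_true_eq] at hok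
  rcases hok with (⟨⟨hpos, hnum⟩, hG0⟩ | ⟨hgc, hvac⟩) | hcert
  · exact (vacuous_of_num_neg (L := L) hL3 hlam hla hlb hpos hnum hG0 hΔ0 hΔ1 hΔe).elim
  · exfalso
    have hmd := mem_delta_cell L hL3 hlam hla hlb hgc
    rw [← hΔe] at hmd
    obtain ⟨hlo, hhi⟩ := hmd
    rcases hvac with hneg | hbig
    · have : ((((deltaIv L la lb).2 : ℤ)) : ℝ) < 0 := by exact_mod_cast hneg
      nlinarith
    · have hbig' : (d1 : ℝ) * ((D : ℤ) : ℝ) < ((((deltaIv L la lb).1 : ℤ)) : ℝ) := by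
        have := hbig
        have e : (((D : ℚ)) : ℝ) = ((D : ℤ) : ℝ) := by norm_cast
        rw [← e]; exact_mod_cast this
      nlinarith
  · exact sdzN_cell_sound hL hΔ0.le hΔ1 hf hla hlb hnt hcert

end FinXD

end Summit.HubbardSuperconductivity.HubbardSuperconductivity.Theorems.AnisotropyChord.Transfer.Fibre3
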